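import Summits.ResolutionOfSingularities.ResolutionOfSingularities.Theorems.EquisingularLiftEquisingularLiftNatOneStepPoints
import Summits.ResolutionOfSingularities.ResolutionOfSingularities.Theorems.EquisingularLiftEquisingularLiftNatSpecimenCayleyCubic
import Mathlib.RingTheory.Polynomial.GaussLemma
import Mathlib.Algebra.Polynomial.FieldDivision
import Literature.AlgebraicGeometry.Resolution.KollarMaxContactChartsFieldChange
import HarnessLib

/-!
# [OURS · L1 W4.5(b)] EL♮ FOR THE `3A₂` CUBIC SURFACE `x₀x₁x₂ + x₃³ = 0`, EVERY CHARACTERISTIC — first specimen of T-ONESTEP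
# `OneStep.elNatAt_oneStepPoints` (crux `Theses.EquisingularLift.EquisingularLiftNat`, stmt-ResolutionOfSingularities-20038)

NOT a statement of any manuscript; OURS kernel specimen (cell `res-hironaka`, chain w45b; seat res-D-pv-013, own initiative, counted 0). AI-written,
weaker than expert review. No `sorry`, standard axioms. One definition (`ThreeA2Cubic.form`) for readability.

The cubic surface `F = x₀x₁x₂ + x₃³ = 0 ⊂ ℙ³_K` has exactly three singular points, the vertices `P₀, P₁, P₂`, each an `A₂` point (in every characteristic,
including `3`): the charts `F(x_c := 1)`, `c = 0, 1, 2`, are all `f = y₀y₁ + y₂³`, whose tangent cone `y₀y₁` is a SINGULAR quadric, so T-MULTIORD does not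
apply; but `f` is a ONE-STEP point: its strict transforms on the three charts of the blow-up of the origin are `G₀ = T₁ + T₀T₂³`, `G₁ = T₀ + T₁T₂³`,
`G₂ = T₀T₁ + T₂`, each with a partial derivative equal to `1`. The chart `F(x₃ := 1) = y₀y₁y₂ + 1` is smooth (`∂₀ = y₁y₂` is a unit modulo `f₃` at every
prime). Hence `OneStep.elNatAt_oneStepPoints` with `S = [0, 1, 2]`: ONE blow-up of `ℙ³_{𝕎(K)}` along the three `𝕎(K)`-points resolves.

* `ThreeA2Cubic.form`, `isHomogeneous_form`, `form_eq`, `dehomogenize_form_of_ne` (`c ≠ 3`; variables via `CayleyCubic.dehomogenize_X_of_succAbove_eq`), `dehomogenize_form_three`, `strictTransform_zero/one/two`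
  (the identities `f(T_l, T_lT_j) = T_l²·G_l`), `jacobian_zero/one/two`, `chartEqn_singular_only_origin`, `isRegularRing_chartRing_three`, `prime_form`,
  `not_isRegular` (the vertices are genuine singular points);
* **`ThreeA2Cubic.elNatAt_threeA2Cubic`** — EL♮ for the `3A₂` cubic surface, every `p`.

References: J. W. Bruce, C. T. C. Wall, *On the classification of cubic surfaces*, J. London Math. Soc. 19 (1979) (the `3A₂` cubic); Hartshorne I Ex. 5.8;
Matsumura Thm. 14.2 — through the cited tree files.
-/

set_option linter.dupNamespace false -- mandated namespace `Summit.<Summit>.<Problem>` of this single-conjunct summit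

noncomputable section

open CategoryTheory AlgebraicGeometry
open MvPolynomial
open Literature.AlgebraicGeometry.Resolution
open Literature.AlgebraicGeometry.Motives Literature.AlgebraicGeometry.Motives.SmoothHypersurface
open Literature.AlgebraicGeometry.Motives.ProjectiveSpace

namespace Summit.ResolutionOfSingularities.ResolutionOfSingularities.Cruxes.EquisingularLiftNat.Sections

namespace ThreeA2Cubic

variable (K : Type) [Field K]

/-! ## The form and its charts -/

/-- **The `3A₂` cubic form** `F = x₀·(x₁x₂) + x₃³ ∈ K[x₀,…,x₃]`, in `x₀`-adic shape. [folklore] -/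
def form : MvPolynomial (Fin (1 + 2 + 1)) K :=
  X 0 * rename Fin.succ (X 0 * X 1 : MvPolynomial (Fin 3) K) + rename Fin.succ (X 2 ^ 3 : MvPolynomial (Fin 3) K)

/-- `y₂³` is homogeneous of degree `3`. [folklore] -/
theorem cube_isHomogeneous : (X 2 ^ 3 : MvPolynomial (Fin 3) K).IsHomogeneous 3 := by
  simpa using (isHomogeneous_X K 2).pow 3

/-- `F` is homogeneous of degree `3`. [folklore] -/
theorem isHomogeneous_form : (form K).IsHomogeneous 3 := by
  have hq : (rename Fin.succ (X 0 * X 1 : MvPolynomial (Fin 3) K) : MvPolynomial (Fin (1 + 2 + 1)) K).IsHomogeneous 2 :=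
    (by simpa using (isHomogeneous_X K 0).mul (isHomogeneous_X K 1) : (X 0 * X 1 : MvPolynomial (Fin 3) K).IsHomogeneous 2).rename_isHomogeneous
  have hc : (rename Fin.succ (X 2 ^ 3 : MvPolynomial (Fin 3) K) : MvPolynomial (Fin (1 + 2 + 1)) K).IsHomogeneous 3 :=
    (cube_isHomogeneous K).rename_isHomogeneous
  have h0 : ((X 0 : MvPolynomial (Fin (1 + 2 + 1)) K) * rename Fin.succ (X 0 * X 1 : MvPolynomial (Fin 3) K)).IsHomogeneous 3 := by
    simpa using (isHomogeneous_X K 0).mul hq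
  exact h0.add hc

/-- `F` written out in the variables of `ℙ³`. [folklore] -/
theorem form_eq : form K = X 0 * X 1 * X 2 + X 3 ^ 3 := by
  simp only [form, map_mul, map_pow, rename_X]
  change X 0 * (X (1 : Fin (1 + 2 + 1)) * X 2) + X 3 ^ 3 = _
  ring

/-- `y₂³ ∈ (y)³`. [folklore] -/
theorem cube_mem_pow : (X 2 ^ 3 : MvPolynomial (Fin 3) K) ∈ Ideal.span (Set.range (X : Fin 3 → MvPolynomial (Fin 3) K)) ^ (2 + 1) :=
  Ideal.pow_mem_pow (Ideal.subset_span (Set.mem_range_self (2 : Fin 3))) (2 + 1)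

/-- `y₀y₁ ≠ 0`. [folklore] -/
theorem quad_ne_zero : (X 0 * X 1 : MvPolynomial (Fin 3) K) ≠ 0 :=
  mul_ne_zero (X_ne_zero _) (X_ne_zero _)

/-- `dehomogenize` on `F` from its values on the variables. [folklore] -/
theorem dehomogenize_form_of_values (c : Fin (1 + 2 + 1)) (v0 v1 v2 v3 : MvPolynomial (Fin 3) K)
    (h0 : dehomogenize K c (X 0) = v0) (h1 : dehomogenize K c (X 1) = v1) (h2 : dehomogenize K c (X 2) = v2) (h3 : dehomogenize K c (X 3) = v3) :
    dehomogenize K c (form K) = v0 * v1 * v2 + v3 ^ 3 := by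
  rw [form_eq]
  simp only [map_add, map_mul, map_pow, h0, h1, h2, h3]

/-- **The three singular charts are `f = y₀y₁ + y₂³`**: `F(x_c := 1) = y₀y₁ + y₂³` for `c = 0, 1, 2`. [folklore] -/
theorem dehomogenize_form_of_ne (c : Fin (1 + 2 + 1)) (hc : c ≠ 3) :
    dehomogenize K c (form K) = X 0 * X 1 + X 2 ^ 3 := by
  have hc' : c = 0 ∨ c = 1 ∨ c = 2 := by
    fin_cases c
    · exact Or.inl rfl
    · exact Or.inr (Or.inl rfl)
    · exact Or.inr (Or.inr rfl)
    · exact absurd rfl hc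
  rcases hc' with rfl | rfl | rfl
  · rw [dehomogenize_form_of_values K 0 _ _ _ _ (dehomogenize_X_self K 0) (CayleyCubic.dehomogenize_X_of_succAbove_eq K 0 0 1 (by decide))
      (CayleyCubic.dehomogenize_X_of_succAbove_eq K 0 1 2 (by decide)) (CayleyCubic.dehomogenize_X_of_succAbove_eq K 0 2 3 (by decide))]
    ring
  · rw [dehomogenize_form_of_values K 1 _ _ _ _ (CayleyCubic.dehomogenize_X_of_succAbove_eq K 1 0 0 (by decide)) (dehomogenize_X_self K 1)
      (CayleyCubic.dehomogenize_X_of_succAbove_eq K 1 1 2 (by decide)) (CayleyCubic.dehomogenize_X_of_succAbove_eq K 1 2 3 (by decide))]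
    ring
  · rw [dehomogenize_form_of_values K 2 _ _ _ _ (CayleyCubic.dehomogenize_X_of_succAbove_eq K 2 0 0 (by decide)) (CayleyCubic.dehomogenize_X_of_succAbove_eq K 2 1 1 (by decide))
      (dehomogenize_X_self K 2) (CayleyCubic.dehomogenize_X_of_succAbove_eq K 2 2 3 (by decide))]
    ring

/-- **The smooth chart** `F(x₃ := 1) = y₀y₁y₂ + 1`. [folklore] -/
theorem dehomogenize_form_three : dehomogenize K (3 : Fin (1 + 2 + 1)) (form K) = X 0 * X 1 * X 2 + 1 := by
  rw [dehomogenize_form_of_values K 3 _ _ _ _ (CayleyCubic.dehomogenize_X_of_succAbove_eq K 3 0 0 (by decide)) (CayleyCubic.dehomogenize_X_of_succAbove_eq K 3 1 1 (by decide))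
    (CayleyCubic.dehomogenize_X_of_succAbove_eq K 3 2 2 (by decide)) (dehomogenize_X_self K 3)]
  ring

/-! ## The strict transforms of `f = y₀y₁ + y₂³` on the three charts of the blow-up of the origin -/

/-- The total-transform substitution on the variables: `y_l ↦ T_l`, `y_j ↦ T_lT_j`. [folklore] -/
theorem aeval_subst_X (l j : Fin 3) :
    aeval (fun i => X l * Function.update (X : Fin 3 → MvPolynomial (Fin 3) K) l 1 i) (X j : MvPolynomial (Fin 3) K) =
      X l * Function.update (X : Fin 3 → MvPolynomial (Fin 3) K) l 1 j :=
  aeval_X _ j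

/-- Chart `l = 0`: `f(T₀, T₀T₁, T₀T₂) = T₀² · (T₁ + T₀T₂³)`. [folklore] -/
theorem strictTransform_zero : aeval (fun i => X 0 * Function.update (X : Fin 3 → MvPolynomial (Fin 3) K) 0 1 i)
    (X 0 * X 1 + X 2 ^ 3 : MvPolynomial (Fin 3) K) = X 0 ^ 2 * (X 1 + X 0 * X 2 ^ 3) := by
  simp only [map_add, map_mul, map_pow, aeval_subst_X, Function.update_self,
    Function.update_of_ne (show (1 : Fin 3) ≠ 0 by decide), Function.update_of_ne (show (2 : Fin 3) ≠ 0 by decide)]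
  ring

/-- Chart `l = 1`: `f(T₁T₀, T₁, T₁T₂) = T₁² · (T₀ + T₁T₂³)`. [folklore] -/
theorem strictTransform_one : aeval (fun i => X 1 * Function.update (X : Fin 3 → MvPolynomial (Fin 3) K) 1 1 i)
    (X 0 * X 1 + X 2 ^ 3 : MvPolynomial (Fin 3) K) = X 1 ^ 2 * (X 0 + X 1 * X 2 ^ 3) := by
  simp only [map_add, map_mul, map_pow, aeval_subst_X, Function.update_self,
    Function.update_of_ne (show (0 : Fin 3) ≠ 1 by decide), Function.update_of_ne (show (2 : Fin 3) ≠ 1 by decide)]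
  ring

/-- Chart `l = 2`: `f(T₂T₀, T₂T₁, T₂) = T₂² · (T₀T₁ + T₂)`. [folklore] -/
theorem strictTransform_two : aeval (fun i => X 2 * Function.update (X : Fin 3 → MvPolynomial (Fin 3) K) 2 1 i)
    (X 0 * X 1 + X 2 ^ 3 : MvPolynomial (Fin 3) K) = X 2 ^ 2 * (X 0 * X 1 + X 2) := by
  simp only [map_add, map_mul, map_pow, aeval_subst_X, Function.update_self,
    Function.update_of_ne (show (0 : Fin 3) ≠ 2 by decide), Function.update_of_ne (show (1 : Fin 3) ≠ 2 by decide)]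
  ring

/-- `∂₁ G₀ = 1`. [folklore] -/
theorem pderiv_one_G₀ : pderiv 1 (X 1 + X 0 * X 2 ^ 3 : MvPolynomial (Fin 3) K) = 1 := by
  simp only [map_add, Derivation.leibniz, Derivation.leibniz_pow, pderiv_X_self, pderiv_X_of_ne (show (0 : Fin 3) ≠ 1 by decide),
    pderiv_X_of_ne (show (2 : Fin 3) ≠ 1 by decide), smul_zero, add_zero]

/-- `∂₀ G₁ = 1`. [folklore] -/
theorem pderiv_zero_G₁ : pderiv 0 (X 0 + X 1 * X 2 ^ 3 : MvPolynomial (Fin 3) K) = 1 := by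
  simp only [map_add, Derivation.leibniz, Derivation.leibniz_pow, pderiv_X_self, pderiv_X_of_ne (show (1 : Fin 3) ≠ 0 by decide),
    pderiv_X_of_ne (show (2 : Fin 3) ≠ 0 by decide), smul_zero, add_zero]

/-- `∂₂ G₂ = 1`. [folklore] -/
theorem pderiv_two_G₂ : pderiv 2 (X 0 * X 1 + X 2 : MvPolynomial (Fin 3) K) = 1 := by
  simp only [map_add, Derivation.leibniz, pderiv_X_self, pderiv_X_of_ne (show (0 : Fin 3) ≠ 2 by decide),
    pderiv_X_of_ne (show (1 : Fin 3) ≠ 2 by decide), smul_zero, add_zero, zero_add]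

/-- **The one-step data of `f = y₀y₁ + y₂³`**: on every chart `l` of the blow-up of the origin the explicit strict transform `G_l` has a partial derivative
equal to `1`, so it passes the Jacobian criterion everywhere. [folklore] -/
theorem oneStep_data (l : Fin 3) : ∃ G : MvPolynomial (Fin 3) K,
    aeval (fun j => X l * Function.update (X : Fin 3 → MvPolynomial (Fin 3) K) l 1 j) (X 0 * X 1 + X 2 ^ 3 : MvPolynomial (Fin 3) K) = X l ^ 2 * G ∧
    ∀ P : Ideal (MvPolynomial (Fin 3) K), P.IsPrime → (X l : MvPolynomial (Fin 3) K) ∈ P → G ∈ P → ∃ j, pderiv j G ∉ P := by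
  have hone : ∀ (P : Ideal (MvPolynomial (Fin 3) K)), P.IsPrime → (1 : MvPolynomial (Fin 3) K) ∉ P := fun P hP h =>
    hP.ne_top ((Ideal.eq_top_iff_one _).mpr h)
  fin_cases l
  · refine ⟨X 1 + X 0 * X 2 ^ 3, strictTransform_zero K, fun P hP _ _ => ⟨1, ?_⟩⟩
    rw [pderiv_one_G₀]
    exact hone P hP
  · refine ⟨X 0 + X 1 * X 2 ^ 3, strictTransform_one K, fun P hP _ _ => ⟨0, ?_⟩⟩
    rw [pderiv_zero_G₁]
    exact hone P hP
  · refine ⟨X 0 * X 1 + X 2, strictTransform_two K, fun P hP _ _ => ⟨2, ?_⟩⟩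
    rw [pderiv_two_G₂]
    exact hone P hP

/-! ## The singular charts are singular only at the origin; the fourth chart is smooth -/

/-- `∂₀ f = y₁` and `∂₁ f = y₀` for `f = y₀y₁ + y₂³`. [folklore] -/
theorem pderiv_zero_f : pderiv 0 (X 0 * X 1 + X 2 ^ 3 : MvPolynomial (Fin 3) K) = X 1 := by
  simp only [map_add, Derivation.leibniz, Derivation.leibniz_pow, pderiv_X_self, pderiv_X_of_ne (show (1 : Fin 3) ≠ 0 by decide),
    pderiv_X_of_ne (show (2 : Fin 3) ≠ 0 by decide), smul_eq_mul]
  ring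

/-- `∂₁ f = y₀`. [folklore] -/
theorem pderiv_one_f : pderiv 1 (X 0 * X 1 + X 2 ^ 3 : MvPolynomial (Fin 3) K) = X 0 := by
  simp only [map_add, Derivation.leibniz, Derivation.leibniz_pow, pderiv_X_self, pderiv_X_of_ne (show (0 : Fin 3) ≠ 1 by decide),
    pderiv_X_of_ne (show (2 : Fin 3) ≠ 1 by decide), smul_eq_mul]
  ring

/-- **`f = y₀y₁ + y₂³` is singular only at the origin, in every characteristic**: a prime containing `f`, `∂₀f = y₁` and `∂₁f = y₀` contains
`y₂³ = f − y₀y₁`, hence `y₂` (the third partial `3y₂²` is not used, so characteristic `3` is included). [cite: Hartshorne1977, I Ex. 5.8] -/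
theorem chartEqn_singular_only_origin (𝔭 : Ideal (MvPolynomial (Fin 3) K)) (h𝔭 : 𝔭.IsPrime)
    (hf : (X 0 * X 1 + X 2 ^ 3 : MvPolynomial (Fin 3) K) ∈ 𝔭) (hd : ∀ j, pderiv j (X 0 * X 1 + X 2 ^ 3 : MvPolynomial (Fin 3) K) ∈ 𝔭) :
    ∀ j, (X j : MvPolynomial (Fin 3) K) ∈ 𝔭 := by
  have h0 := hd 0
  have h1 := hd 1
  rw [pderiv_zero_f] at h0
  rw [pderiv_one_f] at h1
  have h2 : (X 2 : MvPolynomial (Fin 3) K) ∈ 𝔭 := by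
    apply h𝔭.mem_of_pow_mem 3
    have h := 𝔭.sub_mem hf (𝔭.mul_mem_left (X 0) h0)
    rwa [show (X 0 * X 1 + X 2 ^ 3 - X 0 * X 1 : MvPolynomial (Fin 3) K) = X 2 ^ 3 from by ring] at h
  intro j
  fin_cases j
  · exact h1
  · exact h0
  · exact h2

/-- `∂₀ (y₀y₁y₂ + 1) = y₁y₂`. [folklore] -/
theorem pderiv_zero_f₃ : pderiv 0 (X 0 * X 1 * X 2 + 1 : MvPolynomial (Fin 3) K) = X 1 * X 2 := by
  simp only [map_add, Derivation.map_one_eq_zero, Derivation.leibniz, pderiv_X_self, pderiv_X_of_ne (show (1 : Fin 3) ≠ 0 by decide),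
    pderiv_X_of_ne (show (2 : Fin 3) ≠ 0 by decide), smul_eq_mul]
  ring

/-- **The chart `x₃ = 1` is smooth**: `K[y]/(y₀y₁y₂ + 1)` is a regular ring — at every prime `Q ∋ f₃` the partial `∂₀f₃ = y₁y₂ ∉ Q` (else
`1 = f₃ − y₀·y₁y₂ ∈ Q`). [cite: Matsumura1987, Thm. 14.2] -/
theorem isRegularRing_quotient_f₃ : IsRegularRing (MvPolynomial (Fin 3) K ⧸ Ideal.span {(X 0 * X 1 * X 2 + 1 : MvPolynomial (Fin 3) K)}) := by
  refine Summit.ResolutionOfSingularities.ResolutionOfSingularities.Theorems.MvPolynomial.isRegularRing_quotient_of_pderiv fun Q hQ hfQ => ⟨0, ?_⟩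
  rw [pderiv_zero_f₃]
  intro h
  apply hQ.ne_top ((Ideal.eq_top_iff_one _).mpr ?_)
  have h' := Q.sub_mem hfQ (Q.mul_mem_left (X 0) h)
  rwa [show (X 0 * X 1 * X 2 + 1 - X 0 * (X 1 * X 2) : MvPolynomial (Fin 3) K) = 1 from by ring] at h'

attribute [local instance] MvPolynomial.gradedAlgebra ProjBaseChange.algebraBase in
/-- **The chart ring `ChartRing F 3` is regular** (`≅ K[y]/(y₀y₁y₂ + 1)`, radical since regular rings are reduced). [folklore] -/
theorem isRegularRing_chartRing_three : IsRegularRing (ChartRing (form K) 3 (isHomogeneous_form K)) := by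
  haveI := isRegularRing_quotient_f₃ K
  have hrad : (Ideal.span {(X 0 * X 1 * X 2 + 1 : MvPolynomial (Fin 3) K)}).radical = Ideal.span {(X 0 * X 1 * X 2 + 1 : MvPolynomial (Fin 3) K)} := by
    haveI := IsRegularRing.isReduced' (MvPolynomial (Fin 3) K ⧸ Ideal.span {(X 0 * X 1 * X 2 + 1 : MvPolynomial (Fin 3) K)})
    exact (Ideal.isRadical_iff_quotient_reduced _).mpr inferInstance |>.radical
  obtain ⟨θ, -⟩ := HypersurfaceSpecimen.exists_chartQuotEquiv (form K) (isHomogeneous_form K) 3 _ (dehomogenize_form_three K) hrad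
  exact IsRegularRing.of_ringEquiv θ.symm

/-! ## `F` is prime: degree one in `x₀` with coprime coefficients -/

/-- **`F` is prime.** In `x₀`-adic form `F = (x₁x₂)·x₀ + x₃³` (`finSuccEquiv`): a degree-one polynomial over the UFD `K[x₁,x₂,x₃]` whose coefficients
are coprime (a common divisor divides `x₃³`, so is a power of `x₃` up to a unit, and `x₃ ∤ x₁x₂`) is primitive, hence irreducible by Gauss's lemma, hence
prime. [cite: Hartshorne1977, I Ex. 5.8] -/
theorem prime_form : Prime (form K) := by
  set q : MvPolynomial (Fin 3) K := X 0 * X 1 with hq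
  set cu : MvPolynomial (Fin 3) K := X 2 ^ 3 with hcu
  have hq0 : q ≠ 0 := quad_ne_zero K
  -- `x₀`-adic form
  have hfs : finSuccEquiv K 3 (form K) = Polynomial.C q * Polynomial.X + Polynomial.C cu := by
    rw [form, map_add, map_mul, finSuccEquiv_X_zero]
    have hq' := ConeN.finSuccEquiv_rename_succ K (m := 1) q
    have hc' := ConeN.finSuccEquiv_rename_succ K (m := 1) cu
    rw [hq', hc', mul_comm]
  -- primitive
  have hprim : (Polynomial.C q * Polynomial.X + Polynomial.C cu).IsPrimitive := by
    intro r hr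
    have hrq : r ∣ q := by
      have h := (Polynomial.C_dvd_iff_dvd_coeff r _).mp hr 1
      simpa using h
    have hrc : r ∣ cu := by
      have h := (Polynomial.C_dvd_iff_dvd_coeff r _).mp hr 0
      simpa using h
    obtain ⟨i, hi, hri⟩ := (dvd_prime_pow (X_prime (i := (2 : Fin 3)) (R := K)) 3).mp hrc
    rcases Nat.eq_zero_or_pos i with h0 | hpos
    · rw [h0, pow_zero] at hri
      exact hri.isUnit_iff.mpr isUnit_one
    · exfalso
      have hX2 : (X 2 : MvPolynomial (Fin 3) K) ∣ q :=
        (dvd_pow_self (X 2 : MvPolynomial (Fin 3) K) hpos.ne').trans (hri.symm.dvd.trans hrq)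
      rcases (X_prime (i := (2 : Fin 3)) (R := K)).dvd_or_dvd hX2 with h | h
      · rw [X_dvd_X] at h; exact absurd h (by decide)
      · rw [X_dvd_X] at h; exact absurd h (by decide)
  -- irreducible over the fraction field (degree one), hence irreducible (Gauss), hence prime
  have hqK : algebraMap (MvPolynomial (Fin 3) K) (FractionRing (MvPolynomial (Fin 3) K)) q ≠ 0 := fun h =>
    hq0 ((IsFractionRing.injective (MvPolynomial (Fin 3) K) (FractionRing (MvPolynomial (Fin 3) K))) (h.trans (map_zero _).symm))
  have hirrK : Irreducible (Polynomial.map (algebraMap (MvPolynomial (Fin 3) K) (FractionRing (MvPolynomial (Fin 3) K)))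
      (Polynomial.C q * Polynomial.X + Polynomial.C cu)) := by
    rw [Polynomial.map_add, Polynomial.map_mul, Polynomial.map_C, Polynomial.map_X, Polynomial.map_C]
    exact Polynomial.irreducible_of_degree_eq_one (Polynomial.degree_linear hqK)
  have hirrP : Irreducible (Polynomial.C q * Polynomial.X + Polynomial.C cu) :=
    Polynomial.IsPrimitive.irreducible_of_irreducible_map_of_injective
      (IsFractionRing.injective (MvPolynomial (Fin 3) K) (FractionRing (MvPolynomial (Fin 3) K))) hprim hirrK
  have hirr : Irreducible (form K) := by
    rw [← MulEquiv.irreducible_iff (finSuccEquiv K 3).toMulEquiv]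
    change Irreducible (finSuccEquiv K 3 (form K))
    rw [hfs]
    exact hirrP
  exact hirr.prime

/-! ## The vertices are genuine singular points -/

attribute [local instance] MvPolynomial.gradedAlgebra ProjBaseChange.algebraBase in
/-- **The `3A₂` cubic surface is NOT regular**: at the vertex `[1:0:0:0]` the local ring is `K[y]_{(y)}/(f)` with `f = y₀y₁ + y₂³ ∈ (y)²` (Matsumura 14.2,
tree `notMem_sq_of_isRegularLocalRing_quotient`; the local ring is reached through `Spec (ChartRing F 0) → H` and `ChartRing F 0 ≅ K[y]/(f)`).
[cite: Matsumura1987, Thm. 14.2] -/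
theorem not_isRegular : ¬ Scheme.IsRegular (hypersurface (form K)).left := by
  intro hreg
  have hd : 0 < 3 := by norm_num
  have hdeh := dehomogenize_form_of_ne K 0 (by decide)
  have hrad := OrdPointAt.radical_span_dehomogenize_eq K (form K) 0 (isHomogeneous_form K) (prime_form K) _ _ (by simpa using (isHomogeneous_X K 0).mul (isHomogeneous_X K 1))
    (by norm_num) (cube_mem_pow K) hdeh
  obtain ⟨θ, -⟩ := HypersurfaceSpecimen.exists_chartQuotEquiv (form K) (isHomogeneous_form K) 0 _ hdeh hrad
  have hf𝔪2 : (X 0 * X 1 + X 2 ^ 3 : MvPolynomial (Fin 3) K) ∈ Ideal.span (Set.range (X : Fin 3 → MvPolynomial (Fin 3) K)) ^ 2 := by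
    refine Ideal.add_mem _ ?_ (Ideal.pow_le_pow_right (by norm_num) (cube_mem_pow K))
    rw [pow_two]
    exact Ideal.mul_mem_mul (Ideal.subset_span ⟨_, rfl⟩) (Ideal.subset_span ⟨_, rfl⟩)
  have hf𝔪 : (X 0 * X 1 + X 2 ^ 3 : MvPolynomial (Fin 3) K) ∈ Ideal.span (Set.range (X : Fin 3 → MvPolynomial (Fin 3) K)) :=
    Ideal.pow_le_self two_ne_zero hf𝔪2
  set f : MvPolynomial (Fin 3) K := X 0 * X 1 + X 2 ^ 3 with hfdef
  set 𝔪bar : Ideal (MvPolynomial (Fin 3) K ⧸ Ideal.span {f}) :=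
    (Ideal.span (Set.range (X : Fin 3 → MvPolynomial (Fin 3) K))).map (Ideal.Quotient.mk (Ideal.span {f})) with h𝔪bar
  have h𝔪 : (Ideal.span (Set.range (X : Fin 3 → MvPolynomial (Fin 3) K))).IsPrime := by
    have h := MvPolynomial.isDomain_quotient_span_X (R := K) (Set.univ : Set (Fin 3))
    rw [Set.image_univ] at h
    exact (Ideal.Quotient.isDomain_iff_prime _).mp h
  haveI h𝔪barp : 𝔪bar.IsPrime :=
    Ideal.map_isPrime_of_surjective Ideal.Quotient.mk_surjective (by
      rw [Ideal.mk_ker]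
      exact (Ideal.span_singleton_le_iff_mem _).mpr hf𝔪)
  let w₀ : Spec (CommRingCat.of (ChartRing (form K) 0 (isHomogeneous_form K))) := ⟨𝔪bar.comap θ.toRingHom, Ideal.comap_isPrime _ _⟩
  have h1 : IsRegularLocalRing (Localization.AtPrime w₀.asIdeal) := by
    haveI := hreg ((chart (form K) 0 (isHomogeneous_form K) hd).left w₀)
    haveI := isOpenImmersion_chart_left (form K) 0 (isHomogeneous_form K) hd
    exact IsRegularLocalRing.of_ringEquiv
      ((asIso ((chart (form K) 0 (isHomogeneous_form K) hd).left.stalkMap w₀)) ≪≫ Spec.stalkIso _ w₀).commRingCatIsoToRingEquiv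
  have h2 : IsRegularLocalRing (Localization.AtPrime 𝔪bar) :=
    OrdPoint.isRegularLocalRing_localization_of_ringEquiv θ w₀.asIdeal 𝔪bar (fun x => by rw [Ideal.mem_comap]; rfl) h1
  have hQ : 𝔪bar.comap (Ideal.Quotient.mk (Ideal.span {f})) = Ideal.span (Set.range (X : Fin 3 → MvPolynomial (Fin 3) K)) := by
    rw [h𝔪bar, Ideal.comap_map_of_surjective _ Ideal.Quotient.mk_surjective, ← RingHom.ker_eq_comap_bot, Ideal.mk_ker]
    exact sup_eq_left.mpr ((Ideal.span_singleton_le_iff_mem _).mpr hf𝔪)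
  have h3 := (Summit.ResolutionOfSingularities.ResolutionOfSingularities.Theorems.isRegularLocalRing_localization_quotient_iff
    (Ideal.span {f}) (Ideal.span (Set.range (X : Fin 3 → MvPolynomial (Fin 3) K))) 𝔪bar hQ).mp h2
  rw [Ideal.map_span, Set.image_singleton] at h3
  have hf0 : f ≠ 0 := fun h => by simpa [hfdef] using congrArg (MvPolynomial.eval ![(1 : K), 1, 0]) h
  have ha : algebraMap (MvPolynomial (Fin 3) K) (Localization.AtPrime (Ideal.span (Set.range (X : Fin 3 → MvPolynomial (Fin 3) K)))) f ∈
      IsLocalRing.maximalIdeal _ := by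
    rw [← Localization.AtPrime.map_eq_maximalIdeal]
    exact Ideal.mem_map_of_mem _ hf𝔪
  have ha0 : algebraMap (MvPolynomial (Fin 3) K) (Localization.AtPrime (Ideal.span (Set.range (X : Fin 3 → MvPolynomial (Fin 3) K)))) f ≠ 0 :=
    fun h => hf0 (IsLocalization.injective (Localization.AtPrime (Ideal.span (Set.range (X : Fin 3 → MvPolynomial (Fin 3) K))))
      (Ideal.primeCompl_le_nonZeroDivisors (Ideal.span (Set.range (X : Fin 3 → MvPolynomial (Fin 3) K)))) (h.trans (map_zero _).symm))
  have ha2 : algebraMap (MvPolynomial (Fin 3) K) (Localization.AtPrime (Ideal.span (Set.range (X : Fin 3 → MvPolynomial (Fin 3) K)))) f ∈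
      IsLocalRing.maximalIdeal _ ^ 2 := by
    rw [← Localization.AtPrime.map_eq_maximalIdeal, ← Ideal.map_pow]
    exact Ideal.mem_map_of_mem _ hf𝔪2
  haveI := h3
  exact Literature.AlgebraicGeometry.Resolution.notMem_sq_of_isRegularLocalRing_quotient ha ha0 ha2

/-! ## EL♮ for the `3A₂` cubic surface -/

attribute [local instance] MvPolynomial.gradedAlgebra ProjBaseChange.algebraBase in
/-- **EL♮ FOR THE `3A₂` CUBIC SURFACE `x₀x₁x₂ + x₃³ = 0 ⊂ ℙ³_K`, IN EVERY CHARACTERISTIC** (`K` algebraically closed of characteristic `p`, including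
`p = 3`): an instance of `OneStep.elNatAt_oneStepPoints` with `S = [0, 1, 2]` (the three vertices are `A₂` points — tangent cone `y₀y₁` singular, explicit
strict transforms smooth along the exceptional divisor; every singular chart is singular only at its origin; the chart `x₃ = 1` is smooth) — ONE horizontal E1
step along the three `𝕎(K)`-points resolves. [OURS · L1 W4.5b] [folklore] -/
theorem elNatAt_threeA2Cubic (p : ℕ) (hp : p.Prime) (K : Type) [Field K] [CharP K p] [IsAlgClosed K] :
    Theorems.EquisingularLift.ELNatAt p K 3 (hypersurface (form K)).left (hypersurfaceι (form K)).left := by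
  refine OneStep.elNatAt_oneStepPoints p hp K (form K) (isHomogeneous_form K) (prime_form K) [0, 1, 2] (by decide)
    (fun c hc => ?_) (fun c hc P hP hf hd => ?_) (fun c hc => ?_)
  · have hc3 : c ≠ 3 := by
      rintro rfl
      exact absurd hc (by decide)
    exact ⟨2, _, _, by norm_num, by simpa using (isHomogeneous_X K 0).mul (isHomogeneous_X K 1), quad_ne_zero K, cube_mem_pow K,
      dehomogenize_form_of_ne K c hc3, oneStep_data K⟩
  · have hc3 : c ≠ 3 := by
      rintro rfl
      exact absurd hc (by decide)
    rw [dehomogenize_form_of_ne K c hc3] at hf hd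
    exact chartEqn_singular_only_origin K P hP hf hd
  · have hc3 : c = 3 := by
      fin_cases c
      · exact absurd (by decide) hc
      · exact absurd (by decide) hc
      · exact absurd (by decide) hc
      · rfl
    subst hc3
    exact isRegularRing_chartRing_three K

end ThreeA2Cubic

end Summit.ResolutionOfSingularities.ResolutionOfSingularities.Cruxes.EquisingularLiftNat.Sections

end
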